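import Mathlib.Combinatorics.SimpleGraph.Coloring.Vertex
import Literature.Computability.Complexity.OneInThreeSATGadget
import HarnessLib

/-!
# Karp's graph for `SATISFIABILITY WITH AT MOST 3 LITERALS PER CLAUSE ∝ CHROMATIC NUMBER`:
the combinatorial half of the discharge of `isNPComplete_CHROMATIC`

Karp 1972, proof of the Main Theorem, reduction "SATISFIABILITY WITH AT MOST 3 LITERALS PER
CLAUSE ∝ CHROMATIC NUMBER": for clauses `D₁, …, D_r` over the literals `u₁, …, u_m, ū₁, …, ū_m`
the graph on the nodes `{uᵢ} ∪ {ūᵢ} ∪ {vᵢ} ∪ {D_f}` with the arcs `{uᵢ, ūᵢ}`, `{vᵢ, vⱼ} (i ≠ j)`,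
`{vᵢ, uⱼ}, {vᵢ, ūⱼ} (i ≠ j)`, `{uᵢ, D_f} (uᵢ ∉ D_f)`, `{ūᵢ, D_f} (ūᵢ ∉ D_f)` is `(m + 1)`-colourable
iff the clause set is satisfiable (the `vᵢ` form a clique; `uᵢ, ūᵢ` take the colour of `vᵢ` or the
one spare colour, in opposite ways — the truth value —, and a clause node cannot take the spare
colour, so it takes the colour of a TRUE literal it contains).

This file proves the graph-level statement in the form the machine half emits. To avoid renaming
the variables of a code (arbitrary binary numerals) into `1, …, m`, the role of Karp's variable
index `i` is played by a LITERAL SLOT `p = (clause i, position j)`, `j < 3`, of the input padded to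
three slots per clause (`OneInThree.pad3`: the last literal repeated); slots carrying the same
variable are tied by the arcs `{u_p, ū_q}` (same variable), which for `p = q` is Karp's arc
`{uᵢ, ūᵢ}` and for `p ≠ q` forces equal truth values. Every clause node is tripled
(`D_{f,0}, D_{f,1}, D_{f,2}`, pairwise non-adjacent twins with equal neighbourhoods) so that all four
node kinds are indexed by the same set `Fin r × Fin 3`; twins do not affect colourability. So the
vertex set is `Kind × (Fin r × Fin 3)` (`12 r` nodes) and `k = 3 r + 1`.

* `KarpChromatic.Adj L` / `KarpChromatic.graph L` — the graph determined by the slot literals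
  `L : Fin r × Fin 3 → Literal ℕ`;
* `KarpChromatic.colorable_of_slots`, `KarpChromatic.exists_true_slot`,
  `KarpChromatic.fst_eq_of_cl_spare` — the two directions of Karp's argument on slot literals;
* `KarpChromatic.slotLit φ` — the slot literals of a CNF (via `pad3`), and
  **`KarpChromatic.colorable_iff_satisfiable`**: for a CNF of width `≤ 3` without empty clauses,
  `(graph (slotLit φ)).Colorable (φ.length * 3 + 1) ↔ φ.Satisfiable`.

## References

* [Karp1972] R. M. Karp, *Reducibility among combinatorial problems*, in: Complexity of Computer
  Computations (Plenum, 1972) 85–103, §4, proof of the Main Theorem, reduction `SATISFIABILITY WITH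
  AT MOST 3 LITERALS PER CLAUSE ∝ CHROMATIC NUMBER` (node set `N`, arc set `A`, `k = m + 1`).
* [GareyJohnson1979] M. R. Garey, D. S. Johnson, *Computers and Intractability* (1979), [GT4]
  CHROMATIC NUMBER ("Transformation from 3SAT", Karp 1972).
-/

namespace Literature.Computability.Complexity

namespace KarpChromatic

/-! ### Node kinds and the graph of a family of slot literals -/

/-- The four kinds of nodes of Karp's graph: the clique node `v_p`, the positive literal node
`u_p`, the negative literal node `ū_p` of a slot `p`, and (a twin of) the clause node `D_f`.
[cite: Karp1972, §4 Main Theorem (proof), SAT≤3 ∝ CHROMATIC NUMBER] -/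
inductive Kind : Type
  | v : Kind
  | pos : Kind
  | neg : Kind
  | cl : Kind
  deriving DecidableEq, Repr

/-- The numbering of the kinds used by the code of the graph: `0 ↦ v, 1 ↦ pos, 2 ↦ neg, 3 ↦ cl`.
[folklore] -/
def kindOfFin : Fin 4 → Kind
  | ⟨0, _⟩ => Kind.v
  | ⟨1, _⟩ => Kind.pos
  | ⟨2, _⟩ => Kind.neg
  | ⟨_ + 3, _⟩ => Kind.cl

/-- The inverse numbering. [folklore] -/
def finOfKind : Kind → Fin 4
  | Kind.v => 0
  | Kind.pos => 1
  | Kind.neg => 2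
  | Kind.cl => 3

/-- `Fin 4 ≃ Kind`. [folklore] -/
def kindEquiv : Fin 4 ≃ Kind where
  toFun := kindOfFin
  invFun := finOfKind
  left_inv i := by
    match i with
    | ⟨0, _⟩ => rfl
    | ⟨1, _⟩ => rfl
    | ⟨2, _⟩ => rfl
    | ⟨3, _⟩ => rfl
    | ⟨n + 4, h⟩ => exact absurd h (by omega)
  right_inv k := by cases k <;> rfl

/-- `Kind` is finite (four elements). [folklore] -/
instance : Fintype Kind := Fintype.ofEquiv (Fin 4) kindEquiv

/-- Values of `kindEquiv`. [folklore] -/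
@[simp] theorem kindEquiv_zero : kindEquiv 0 = Kind.v := rfl
/-- Values of `kindEquiv`. [folklore] -/
@[simp] theorem kindEquiv_one : kindEquiv 1 = Kind.pos := rfl
/-- Values of `kindEquiv`. [folklore] -/
@[simp] theorem kindEquiv_two : kindEquiv 2 = Kind.neg := rfl
/-- Values of `kindEquiv`. [folklore] -/
@[simp] theorem kindEquiv_three : kindEquiv 3 = Kind.cl := rfl

/-- A slot: clause index and position `< 3`. [folklore] -/
abbrev Slot (r : ℕ) : Type := Fin r × Fin 3

/-- The nodes of Karp's graph for `r` clauses: a kind and a slot. [cite: Karp1972, §4 Main Theorem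
(proof), SAT≤3 ∝ CHROMATIC NUMBER] -/
abbrev Vtx (r : ℕ) : Type := Kind × Slot r

variable {r : ℕ}

/-- **The arcs of Karp's graph** on slots (`L p` the literal of slot `p`): `{v_p, v_q}`, `{v_p, u_q}`,
`{v_p, ū_q}` for `p ≠ q`; `{u_p, ū_q}` whenever `p, q` carry the same variable (for `p = q` Karp's
`{uᵢ, ūᵢ}`); `{u_q, D_f}` unless `u_q` is a literal node of clause `f` (i.e. `q` is a slot of `f` with
positive polarity), `{ū_q, D_f}` unless `q` is a slot of `f` with negative polarity.
[cite: Karp1972, §4 Main Theorem (proof), SAT≤3 ∝ CHROMATIC NUMBER] -/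
def Adj (L : Slot r → Literal ℕ) : Vtx r → Vtx r → Prop
  | (Kind.v, p), (Kind.v, q) => p ≠ q
  | (Kind.v, p), (Kind.pos, q) => p ≠ q
  | (Kind.v, p), (Kind.neg, q) => p ≠ q
  | (Kind.pos, p), (Kind.v, q) => p ≠ q
  | (Kind.neg, p), (Kind.v, q) => p ≠ q
  | (Kind.pos, p), (Kind.neg, q) => (L p).1 = (L q).1
  | (Kind.neg, p), (Kind.pos, q) => (L p).1 = (L q).1
  | (Kind.pos, p), (Kind.cl, q) => ¬ (p.1 = q.1 ∧ (L p).2 = true)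
  | (Kind.cl, q), (Kind.pos, p) => ¬ (p.1 = q.1 ∧ (L p).2 = true)
  | (Kind.neg, p), (Kind.cl, q) => ¬ (p.1 = q.1 ∧ (L p).2 = false)
  | (Kind.cl, q), (Kind.neg, p) => ¬ (p.1 = q.1 ∧ (L p).2 = false)
  | _, _ => False

/-- The arc relation is symmetric. [folklore] -/
theorem adj_symm (L : Slot r → Literal ℕ) {a b : Vtx r} (h : Adj L a b) : Adj L b a := by
  obtain ⟨ka, p⟩ := a
  obtain ⟨kb, q⟩ := b
  cases ka <;> cases kb <;> simp only [Adj] at h ⊢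
  all_goals first | exact fun e => h e.symm | exact h.symm | exact h

/-- The arc relation is irreflexive. [folklore] -/
theorem adj_irrefl (L : Slot r → Literal ℕ) (a : Vtx r) : ¬ Adj L a a := by
  obtain ⟨ka, p⟩ := a
  cases ka <;> simp [Adj]

/-- **Karp's graph** of a family of slot literals. [cite: Karp1972, §4 Main Theorem (proof),
SAT≤3 ∝ CHROMATIC NUMBER] -/
def graph (L : Slot r → Literal ℕ) : SimpleGraph (Vtx r) where
  Adj := Adj L
  symm := ⟨fun _ _ h => adj_symm L h⟩
  loopless := ⟨fun a h => adj_irrefl L a h⟩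

/-- Unfolding the adjacency of `graph L`. [folklore] -/
theorem graph_adj (L : Slot r → Literal ℕ) (a b : Vtx r) : (graph L).Adj a b ↔ Adj L a b :=
  Iff.rfl

/-- Adjacency in Karp's graph is decidable. [folklore] -/
instance (L : Slot r → Literal ℕ) : DecidableRel (graph L).Adj := fun a b => by
  obtain ⟨ka, p⟩ := a
  obtain ⟨kb, q⟩ := b
  rw [graph_adj]
  cases ka <;> cases kb <;> simp only [Adj] <;> infer_instance

/-! ### The colours -/

/-- The colour reserved for the clique node `v_p`: the number of the slot `p` (below the spare
colour `Fin.last`). [folklore] -/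
def slotColour (p : Slot r) : Fin (r * 3 + 1) := Fin.castSucc (finProdFinEquiv p)

/-- The spare colour. [folklore] -/
def spare (r : ℕ) : Fin (r * 3 + 1) := Fin.last (r * 3)

/-- Slot colours are injective. [folklore] -/
theorem slotColour_injective : Function.Injective (slotColour (r := r)) :=
  fun _ _ h => finProdFinEquiv.injective (Fin.castSucc_injective _ h)

/-- A slot colour is not the spare colour. [folklore] -/
theorem slotColour_ne_spare (p : Slot r) : slotColour p ≠ spare r :=
  (Fin.castSucc_lt_last _).ne

/-! ### From a satisfying assignment to a colouring -/

section Complete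

variable (L : Slot r → Literal ℕ) (σ : ℕ → Bool) (w : Fin r → Fin 3)

/-- **Karp's colouring from an assignment** `σ` and a choice `w f` of a true slot in every clause:
`v_p ↦ p`, the true one of `u_p, ū_p ↦ p` and the false one `↦ spare`, `D_f ↦ (f, w f)`.
[cite: Karp1972, §4 Main Theorem (proof), SAT≤3 ∝ CHROMATIC NUMBER] -/
def colourOf : Vtx r → Fin (r * 3 + 1)
  | (Kind.v, p) => slotColour p
  | (Kind.pos, p) => if σ (L p).1 then slotColour p else spare r
  | (Kind.neg, p) => if σ (L p).1 then spare r else slotColour p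
  | (Kind.cl, q) => slotColour (q.1, w q.1)

/-- A true literal of slot `p` with positive polarity has `σ (L p).1 = true`, with negative polarity
`σ (L p).1 = false`. [folklore] -/
theorem sigma_eq_of_eval {σ : ℕ → Bool} {l : Literal ℕ} (h : l.eval σ = true) : σ l.1 = l.2 := by
  unfold Literal.eval at h
  simpa using h

/-- **The colouring is proper** when every chosen slot `(f, w f)` carries a literal true under `σ`.
[cite: Karp1972, §4 Main Theorem (proof), SAT≤3 ∝ CHROMATIC NUMBER] -/
theorem colourOf_valid (hw : ∀ f : Fin r, (L (f, w f)).eval σ = true) {a b : Vtx r}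
    (h : (graph L).Adj a b) : colourOf L σ w a ≠ colourOf L σ w b := by
  have hinj := slotColour_injective (r := r)
  rw [graph_adj] at h
  obtain ⟨ka, p⟩ := a
  obtain ⟨kb, q⟩ := b
  cases ka <;> cases kb <;> simp only [Adj] at h <;> simp only [colourOf]
  · -- v / v
    exact fun e => h (hinj e)
  · -- v / pos
    split_ifs with hq
    · exact fun e => h (hinj e)
    · exact slotColour_ne_spare p
  · -- v / neg
    split_ifs with hq
    · exact slotColour_ne_spare p
    · exact fun e => h (hinj e)
  · -- pos / v
    split_ifs with hp
    · exact fun e => h (hinj e)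
    · exact (slotColour_ne_spare q).symm
  · -- pos / neg, same variable
    rw [h]
    split_ifs with hq
    · exact slotColour_ne_spare p
    · exact (slotColour_ne_spare q).symm
  · -- pos / cl
    split_ifs with hp
    · intro e
      have hpq : p = (q.1, w q.1) := hinj e
      have ht := sigma_eq_of_eval (hw q.1)
      rw [← hpq, hp] at ht
      exact h ⟨by rw [hpq], ht.symm⟩
    · exact (slotColour_ne_spare _).symm
  · -- neg / v
    split_ifs with hp
    · exact (slotColour_ne_spare q).symm
    · exact fun e => h (hinj e)
  · -- neg / pos, same variable
    rw [h]
    split_ifs with hq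
    · exact (slotColour_ne_spare q).symm
    · exact slotColour_ne_spare p
  · -- neg / cl
    split_ifs with hp
    · exact (slotColour_ne_spare _).symm
    · intro e
      have hpq : p = (q.1, w q.1) := hinj e
      have ht := sigma_eq_of_eval (hw q.1)
      rw [← hpq] at ht
      simp only [Bool.not_eq_true] at hp
      rw [hp] at ht
      exact h ⟨by rw [hpq], ht.symm⟩
  · -- cl / pos
    split_ifs with hq
    · intro e
      have hqp : (p.1, w p.1) = q := hinj e
      have ht := sigma_eq_of_eval (hw p.1)
      rw [hqp, hq] at ht
      exact h ⟨by rw [← hqp], ht.symm⟩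
    · exact slotColour_ne_spare _
  · -- cl / neg
    split_ifs with hq
    · exact slotColour_ne_spare _
    · intro e
      have hqp : (p.1, w p.1) = q := hinj e
      have ht := sigma_eq_of_eval (hw p.1)
      rw [hqp] at ht
      simp only [Bool.not_eq_true] at hq
      rw [hq] at ht
      exact h ⟨by rw [← hqp], ht.symm⟩

/-- **Completeness**: if some assignment makes a literal of a slot of every clause true, Karp's
graph is `(3r + 1)`-colourable. [cite: Karp1972, §4 Main Theorem (proof), SAT≤3 ∝ CHROMATIC NUMBER] -/
theorem colorable_of_slots (hw : ∀ f : Fin r, (L (f, w f)).eval σ = true) :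
    (graph L).Colorable (r * 3 + 1) :=
  ⟨SimpleGraph.Coloring.mk (colourOf L σ w) fun h => colourOf_valid L σ w hw h⟩

end Complete

/-! ### From a colouring to a satisfying assignment -/

section Sound

variable {L : Slot r → Literal ℕ} (C : (graph L).Coloring (Fin (r * 3 + 1)))

/-- The colours of the clique nodes are pairwise distinct. [cite: Karp1972, §4 Main Theorem (proof),
SAT≤3 ∝ CHROMATIC NUMBER] -/
theorem colour_v_injective : Function.Injective fun p : Slot r => C (Kind.v, p) :=
  fun p q h => by
    by_contra hpq
    exact C.valid (show (graph L).Adj (Kind.v, p) (Kind.v, q) from hpq) h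

/-- **The spare colour of a colouring**: the one colour not used on the clique (there is exactly
one, the clique having `3r` nodes and the palette `3r + 1` colours). [folklore] -/
theorem exists_spare : ∃ c₀ : Fin (r * 3 + 1), (∀ p : Slot r, C (Kind.v, p) ≠ c₀) ∧
    ∀ c, (∀ p : Slot r, C (Kind.v, p) ≠ c) → c = c₀ := by
  classical
  set S : Finset (Fin (r * 3 + 1)) := Finset.univ.image fun p : Slot r => C (Kind.v, p) with hS_def
  have hS : S.card = r * 3 := by
    rw [hS_def, Finset.card_image_of_injective _ (colour_v_injective C)]
    simp
  have hc : (Finset.univ \ S).card = 1 := by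
    rw [Finset.card_univ_sdiff, Fintype.card_fin, hS]
    omega
  obtain ⟨c₀, hc₀⟩ := Finset.card_eq_one.1 hc
  have hmem : ∀ c, c ∈ Finset.univ \ S ↔ ∀ p : Slot r, C (Kind.v, p) ≠ c := fun c => by
    simp [hS_def]
  refine ⟨c₀, (hmem c₀).1 (by rw [hc₀]; exact Finset.mem_singleton_self _), fun c h => ?_⟩
  have := (hmem c).2 h
  rw [hc₀] at this
  exact Finset.mem_singleton.1 this

variable {C}
variable {c₀ : Fin (r * 3 + 1)} (h₁ : ∀ c, (∀ p : Slot r, C (Kind.v, p) ≠ c) → c = c₀)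
include h₁

/-- A colour avoided by the whole clique is the spare colour; so a non-spare colour is the colour
of some clique node. [folklore] -/
theorem exists_v_of_ne_spare {c : Fin (r * 3 + 1)} (hc : c ≠ c₀) : ∃ p : Slot r, C (Kind.v, p) = c := by
  by_contra h
  push Not at h
  exact hc (h₁ c h)

/-- A literal node `u_p` has the colour of `v_p` or the spare colour. [cite: Karp1972, §4 Main
Theorem (proof), SAT≤3 ∝ CHROMATIC NUMBER] -/
theorem colour_pos_eq_or (p : Slot r) : C (Kind.pos, p) = C (Kind.v, p) ∨ C (Kind.pos, p) = c₀ := by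
  by_cases h : C (Kind.pos, p) = c₀
  · exact Or.inr h
  · obtain ⟨q, hq⟩ := exists_v_of_ne_spare h₁ h
    by_cases hqp : q = p
    · subst hqp; exact Or.inl hq.symm
    · exact absurd hq (C.valid (show (graph L).Adj (Kind.v, q) (Kind.pos, p) from hqp))

/-- Likewise for `ū_p`. [cite: Karp1972, §4 Main Theorem (proof), SAT≤3 ∝ CHROMATIC NUMBER] -/
theorem colour_neg_eq_or (p : Slot r) : C (Kind.neg, p) = C (Kind.v, p) ∨ C (Kind.neg, p) = c₀ := by
  by_cases h : C (Kind.neg, p) = c₀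
  · exact Or.inr h
  · obtain ⟨q, hq⟩ := exists_v_of_ne_spare h₁ h
    by_cases hqp : q = p
    · subst hqp; exact Or.inl hq.symm
    · exact absurd hq (C.valid (show (graph L).Adj (Kind.v, q) (Kind.neg, p) from hqp))

/-- **Exactly one of `u_p`, `ū_p` is spare**: `u_p` is spare iff `ū_p` is not (the two are adjacent,
both take the colour of `v_p` or the spare one). [cite: Karp1972, §4 Main Theorem (proof), SAT≤3 ∝
CHROMATIC NUMBER] -/
theorem colour_pos_eq_spare_iff (p : Slot r) : C (Kind.pos, p) = c₀ ↔ C (Kind.neg, p) ≠ c₀ := by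
  have hadj : (graph L).Adj (Kind.pos, p) (Kind.neg, p) := (rfl : (L p).1 = (L p).1)
  constructor
  · intro hp hq
    exact C.valid hadj (hp.trans hq.symm)
  · intro hq
    rcases colour_pos_eq_or h₁ p with hp | hp
    · rcases colour_neg_eq_or h₁ p with hq' | hq'
      · exact absurd (hp.trans hq'.symm) (C.valid hadj)
      · exact absurd hq' hq
    · exact hp

/-- **Slots with the same variable agree**: `u_p` is spare iff `u_q` is (through the arcs
`{u_p, ū_q}`, `{u_q, ū_p}`). [cite: Karp1972, §4 Main Theorem (proof), SAT≤3 ∝ CHROMATIC NUMBER] -/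
theorem colour_pos_eq_spare_iff_of_var_eq {p q : Slot r} (hv : (L p).1 = (L q).1) :
    C (Kind.pos, p) = c₀ ↔ C (Kind.pos, q) = c₀ := by
  have hpq : (graph L).Adj (Kind.pos, p) (Kind.neg, q) := hv
  have hqp : (graph L).Adj (Kind.pos, q) (Kind.neg, p) := hv.symm
  constructor
  · intro hp
    by_contra hq
    have hq' : C (Kind.neg, q) = c₀ := by
      by_contra h
      exact hq ((colour_pos_eq_spare_iff h₁ q).2 h)
    exact C.valid hpq (hp.trans hq'.symm)
  · intro hq
    by_contra hp
    have hp' : C (Kind.neg, p) = c₀ := by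
      by_contra h
      exact hp ((colour_pos_eq_spare_iff h₁ p).2 h)
    exact C.valid hqp (hq.trans hp'.symm)

/-- **The assignment read off a colouring**: a variable occurring in some slot is true iff the
positive literal node of (any, by `colour_pos_eq_spare_iff_of_var_eq`) such slot is not spare;
other variables are false. [cite: Karp1972, §4 Main Theorem (proof), SAT≤3 ∝ CHROMATIC NUMBER] -/
noncomputable def assignment (L : Slot r → Literal ℕ) (C : (graph L).Coloring (Fin (r * 3 + 1)))
    (c₀ : Fin (r * 3 + 1)) : ℕ → Bool := fun x =>
  open Classical in
  if h : ∃ p : Slot r, (L p).1 = x then decide (C (Kind.pos, Classical.choose h) ≠ c₀) else false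

omit h₁ in
/-- Unfolding `assignment` at a variable that occurs. [folklore] -/
theorem assignment_of_exists {x : ℕ} (h : ∃ p : Slot r, (L p).1 = x) :
    assignment L C c₀ x = decide (C (Kind.pos, Classical.choose h) ≠ c₀) := by
  unfold assignment
  rw [dif_pos h]

/-- **The value of the variable of slot `p`**: `u_p` is not spare. [cite: Karp1972, §4 Main Theorem
(proof), SAT≤3 ∝ CHROMATIC NUMBER] -/
theorem assignment_var (p : Slot r) : assignment L C c₀ (L p).1 = decide (C (Kind.pos, p) ≠ c₀) := by
  have h : ∃ q : Slot r, (L q).1 = (L p).1 := ⟨p, rfl⟩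
  rw [assignment_of_exists h]
  have hv : (L (Classical.choose h)).1 = (L p).1 := Classical.choose_spec h
  have := colour_pos_eq_spare_iff_of_var_eq h₁ hv
  by_cases hc : C (Kind.pos, p) = c₀
  · simp [hc, this.2 hc]
  · have hc' : C (Kind.pos, Classical.choose h) ≠ c₀ := fun e => hc (this.1 e)
    simp [hc, hc']

/-- **A clause node of non-spare colour sees a true literal**: if `D_{f,j₀}` is not spare, some slot
of clause `f` carries a literal true under the assignment read off the colouring (`D_{f,j₀}` has the
colour of some `v_p`; the one of `u_p, ū_p` with that colour is not adjacent to `D_{f,j₀}`, i.e. is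
a literal node of clause `f`, and it is the true one). [cite: Karp1972, §4 Main Theorem (proof),
SAT≤3 ∝ CHROMATIC NUMBER] -/
theorem exists_true_slot (h₀ : ∀ p : Slot r, C (Kind.v, p) ≠ c₀) (f : Fin r) (j₀ : Fin 3)
    (hD : C (Kind.cl, (f, j₀)) ≠ c₀) :
    ∃ j : Fin 3, (L (f, j)).eval (assignment L C c₀) = true := by
  obtain ⟨p, hp⟩ := exists_v_of_ne_spare h₁ hD
  have hval : ∀ p : Slot r, (L p).eval (assignment L C c₀) =
      (decide (C (Kind.pos, p) ≠ c₀) == (L p).2) := fun p => by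
    unfold Literal.eval
    rw [assignment_var h₁ p]
  rcases colour_pos_eq_or h₁ p with hu | hu
  · -- `u_p` has the colour of `D`: not adjacent, so `p` is a positive slot of clause `f`
    have hna : ¬ (graph L).Adj (Kind.pos, p) (Kind.cl, (f, j₀)) := fun ha => C.valid ha (hu.trans hp)
    have hpf : p.1 = f ∧ (L p).2 = true := by
      by_contra hn
      exact hna hn
    refine ⟨p.2, ?_⟩
    have hpe : (f, p.2) = p := by rw [← hpf.1]
    rw [hpe, hval p, hpf.2]
    have : C (Kind.pos, p) ≠ c₀ := by rw [hu]; exact h₀ p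
    simp [this]
  · -- `u_p` is spare, so `ū_p` has the colour of `v_p`, i.e. of `D`
    have hn : C (Kind.neg, p) ≠ c₀ := (colour_pos_eq_spare_iff h₁ p).1 hu
    have hn' : C (Kind.neg, p) = C (Kind.v, p) := by
      rcases colour_neg_eq_or h₁ p with h | h
      · exact h
      · exact absurd h hn
    have hna : ¬ (graph L).Adj (Kind.neg, p) (Kind.cl, (f, j₀)) := fun ha => C.valid ha (hn'.trans hp)
    have hpf : p.1 = f ∧ (L p).2 = false := by
      by_contra hn
      exact hna hn
    refine ⟨p.2, ?_⟩
    have hpe : (f, p.2) = p := by rw [← hpf.1]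
    rw [hpe, hval p, hpf.2]
    simp [hu]

/-- **A spare-coloured clause node sees every slot**: if `D_{f,j₀}` is spare then every slot belongs
to clause `f` (one of `u_q, ū_q` is spare, hence not adjacent to `D_{f,j₀}`), so `f` is the only
clause. [cite: Karp1972, §4 Main Theorem (proof), SAT≤3 ∝ CHROMATIC NUMBER] -/
theorem fst_eq_of_cl_spare (f : Fin r) (j₀ : Fin 3) (hD : C (Kind.cl, (f, j₀)) = c₀) (q : Slot r) :
    q.1 = f := by
  by_cases hu : C (Kind.pos, q) = c₀
  · have hna : ¬ (graph L).Adj (Kind.pos, q) (Kind.cl, (f, j₀)) := fun ha => C.valid ha (hu.trans hD.symm)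
    have hqf : q.1 = f ∧ (L q).2 = true := by
      by_contra hn
      exact hna hn
    exact hqf.1
  · have hn : C (Kind.neg, q) = c₀ := by
      by_contra h
      exact hu ((colour_pos_eq_spare_iff h₁ q).2 h)
    have hna : ¬ (graph L).Adj (Kind.neg, q) (Kind.cl, (f, j₀)) := fun ha => C.valid ha (hn.trans hD.symm)
    have hqf : q.1 = f ∧ (L q).2 = false := by
      by_contra hn'
      exact hna hn'
    exact hqf.1

end Sound

/-! ### The slot literals of a CNF and the main equivalence -/

/-- Component `j < 3` of a triple. [folklore] -/
def proj3 {α : Type} (t : α × α × α) (j : Fin 3) : α :=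
  match j with
  | ⟨0, _⟩ => t.1
  | ⟨1, _⟩ => t.2.1
  | ⟨_ + 2, _⟩ => t.2.2

/-- **The slot literals of a clause**: slot `j < 3` carries component `j` of `pad3` of the clause
(the clause padded to three slots by repeating its last literal; a junk literal for the empty
clause, which the main theorem excludes). [cite: Karp1972, §4 Main Theorem (proof), SAT≤3 ∝
CHROMATIC NUMBER] -/
def slotOfClause (c : Clause ℕ) (j : Fin 3) : Literal ℕ :=
  match OneInThree.pad3 c with
  | some t => proj3 t j
  | none => (0, true)

/-- **The slot literals of a CNF**: slot `(i, j)` carries slot `j` of clause `i`.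
[cite: Karp1972, §4 Main Theorem (proof), SAT≤3 ∝ CHROMATIC NUMBER] -/
def slotLit (φ : CNF ℕ) (p : Slot φ.length) : Literal ℕ :=
  slotOfClause φ[p.1] p.2

/-- The slot literals of a nonempty clause are literals of the clause, and one of them is true
whenever the clause (of width `≤ 3`) is. [folklore] -/
theorem slotOfClause_spec (c : Clause ℕ) (hne : c ≠ []) :
    (∀ j, slotOfClause c j ∈ c) ∧ ∀ σ : ℕ → Bool, c.length ≤ 3 →
      Clause.eval σ c = true → ∃ j, (slotOfClause c j).eval σ = true := by
  unfold slotOfClause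
  cases hpad : OneInThree.pad3 c with
  | none => exact absurd (OneInThree.eq_nil_of_pad3_eq_none hpad) hne
  | some t =>
    obtain ⟨l₁, l₂, l₃⟩ := t
    obtain ⟨h₁, h₂, h₃⟩ := OneInThree.mem_of_pad3 hpad
    refine ⟨fun j => ?_, fun σ hw hc => ?_⟩
    · match j with
      | ⟨0, _⟩ => exact h₁
      | ⟨1, _⟩ => exact h₂
      | ⟨2, _⟩ => exact h₃
    · have h := OneInThree.pad3_or_eq_eval σ hw hpad
      rw [hc] at h
      simp only [Bool.or_eq_true] at h
      rcases h with (h | h) | h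
      · exact ⟨0, h⟩
      · exact ⟨1, h⟩
      · exact ⟨2, h⟩

/-- The same for the slot literals of a CNF. [folklore] -/
theorem slotLit_spec (φ : CNF ℕ) (i : Fin φ.length) (hne : φ[i] ≠ []) :
    (∀ j, slotLit φ (i, j) ∈ φ[i]) ∧ ∀ σ : ℕ → Bool, φ[i].length ≤ 3 →
      Clause.eval σ φ[i] = true → ∃ j, (slotLit φ (i, j)).eval σ = true :=
  slotOfClause_spec φ[i] hne

/-- A single nonempty clause is satisfiable. [folklore] -/
theorem clause_eval_of_ne_nil {c : Clause ℕ} (hc : c ≠ []) :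
    ∃ σ : ℕ → Bool, Clause.eval σ c = true := by
  obtain ⟨l, rest, rfl⟩ := List.exists_cons_of_ne_nil hc
  refine ⟨fun x => if x = l.1 then l.2 else false, ?_⟩
  simp [Clause.eval, Literal.eval]

/-- **Karp's equivalence** (SATISFIABILITY WITH AT MOST 3 LITERALS PER CLAUSE ∝ CHROMATIC NUMBER):
for a CNF of width `≤ 3` without empty clauses, the graph of its slot literals is
`(3r + 1)`-colourable iff the CNF is satisfiable. [cite: Karp1972, §4 Main Theorem (proof), SAT≤3 ∝
CHROMATIC NUMBER] -/
theorem colorable_iff_satisfiable (φ : CNF ℕ) (hw : φ.IsWidthLE 3) (hne : ([] : Clause ℕ) ∉ φ) :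
    (graph (slotLit φ)).Colorable (φ.length * 3 + 1) ↔ φ.Satisfiable := by
  have hne' : ∀ i : Fin φ.length, φ[i] ≠ [] := fun i h => hne (h ▸ List.getElem_mem i.2)
  constructor
  · rintro ⟨C⟩
    obtain ⟨c₀, h₀, h₁⟩ := exists_spare C
    by_cases hcl : ∃ f : Fin φ.length, C (Kind.cl, (f, 0)) = c₀
    · -- a spare clause node: `f` is the only clause, and a nonempty clause is satisfiable
      obtain ⟨f, hf⟩ := hcl
      obtain ⟨σ, hσ⟩ := clause_eval_of_ne_nil (hne' f)
      refine ⟨σ, (CNF.eval_eq_true_iff φ σ).2 fun c hc => ?_⟩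
      obtain ⟨i, hi, rfl⟩ := List.getElem_of_mem hc
      have hif : (⟨i, hi⟩ : Fin φ.length) = f := fst_eq_of_cl_spare h₁ f 0 hf (⟨i, hi⟩, 0)
      have : φ[i] = φ[f] := by simp [← hif]
      rw [this]
      exact hσ
    · push Not at hcl
      refine ⟨assignment (slotLit φ) C c₀, (CNF.eval_eq_true_iff φ _).2 fun c hc => ?_⟩
      obtain ⟨i, hi, rfl⟩ := List.getElem_of_mem hc
      obtain ⟨j, hj⟩ := exists_true_slot h₁ h₀ ⟨i, hi⟩ 0 (hcl ⟨i, hi⟩)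
      have hmem := (slotLit_spec φ ⟨i, hi⟩ (hne' ⟨i, hi⟩)).1 j
      simp only [Clause.eval, List.any_eq_true]
      exact ⟨_, hmem, hj⟩
  · rintro ⟨σ, hσ⟩
    have hcl : ∀ i : Fin φ.length, ∃ j, (slotLit φ (i, j)).eval σ = true := fun i =>
      (slotLit_spec φ i (hne' i)).2 σ (hw _ (List.getElem_mem i.2))
        ((CNF.eval_eq_true_iff φ σ).1 hσ _ (List.getElem_mem i.2))
    choose w hw' using hcl
    exact colorable_of_slots (slotLit φ) σ w hw'

end KarpChromatic

end Literature.Computability.Complexity
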